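import Literature.Barriers.FinalStateConjecture.ExtremalHorizonNearHorizonEnergy
import HarnessLib

/-!
# Barrier catalogue `FinalStateConjecture`: `Aretakis2012_uniformBoundedness` follows from
# `Aretakis2012_integratedDecay` — §13.1 of Aretakis 2012 with a Lagrangian profile that removes
# the angular derivative from the transition-region error
# (`Literature/Barriers/FinalStateConjecture/`, D-0021, D-0014; family `gr`)

Written from the proving seat of
`Literature.Barriers.FinalStateConjecture.Aretakis2012_uniformBoundedness` (Aretakis, JFA 263
(2012), Thm. 2 in shell form; child 1 of `Aretakis2012_pointwiseDecay` in
`ExtremalHorizonAxisymmetricDecayDecomposition.lean`). `ExtremalHorizonNearHorizonEnergy.lean`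
proves §13.1 of the source for the class with the integrated local energy decay of Prop. 12.5.1 on
a transition shell `{A ≤ r ≤ B}` as hypothesis, for the energy-type density
`Φ² + (TΦ)² + (∂_ρΦ)² + (∂_ΘΦ)²`. **This file removes the angular derivative from that hypothesis
and then discharges it from the sibling fact `Aretakis2012_integratedDecay`** (child 2: integrability
in time of `∫∫∫_M^{R₂} sin θ (Φ² + (r − M)²(∂_ρΦ)²)` for some `R₂ > M`, for every member of the
class):

* In the cut-off current of §13.1 the Lagrangian coefficient is free in the transition region; the
  choice `w = −χ/2 + ½χ'N^Y` (still `−½` on the collar and `0` beyond `B`) makes the coefficient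
  `½f' − w` of `(∂_θG)²` in the bulk equal to `−χ/2 ≤ 0`, so that the bulk is bounded ABOVE in the
  transition shell by `K sin θ ((∂_{t*}G)² + (∂_rG)² + G²)`
  (`Kerr.exists_bound_multBulk_le`, `ExtremalHorizonCutoffCurrent.lean`) — and an upper bound of
  the bulk is all the energy identity uses. Hence
  `Kerr.collar_rhoDeriv_sq_le_of_transitionILED₃`: the collar bound from
  `∫₀^τ ∫₀^{2π}∫₀^π∫_A^B sin θ (Φ² + (TΦ)² + (∂_ρΦ)²) dt ≤ I`, and
  `Aretakis2012_uniformBoundedness_of_transitionILED₃`.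
* `Aretakis2012_uniformBoundedness_of_integratedDecay :
  Aretakis2012_integratedDecay → Aretakis2012_uniformBoundedness` — the three-term hypothesis on a
  shell `[A, B] ⊂ (M, min(R₂, R₂', 23M/21))` follows from `Aretakis2012_integratedDecay` applied to
  `Φ` (terms `Φ²`, `(r − M)²(∂_ρΦ)² ≥ (A − M)²(∂_ρΦ)²`) and to `TΦ` (term `(TΦ)²`; the class is
  closed under `T`, `Kerr.timeDeriv_in_class`), the time integrals `∫₀^τ` being bounded by
  `∫₀^{T₀} + ∫_{(T₀, ∞)}`.
* `Aretakis2012_pointwiseDecay_of_integratedDecay :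
  Aretakis2012_integratedDecay → Aretakis2012_pointwiseDecay` — so the parent fact (Thm. 5) now
  rests on child 2 alone (`Aretakis2012_pointwiseDecay_holds_of`).

Everything is proved; no named facts (D-0026). In the source this corresponds to the remark that
Thm. 2 (uniform boundedness) is derived from the dispersive estimates (§1.2.3: "Using the above
integrated local energy decay and a novel current … we infer boundedness of the non-degenerate
energy"); the integrated decay needed is only that of `ψ`, `Tψ` and the DEGENERATE transversal
derivative on a thin shell near `𝓗⁺`.

## References

* S. Aretakis, *Decay of axisymmetric solutions of the wave equation on extreme Kerr
  backgrounds*, J. Funct. Anal. 263 (2012) 2770–2831 (arXiv:1110.2006): §13.1 (proof of Thm. 2),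
  §1.2.3, §7.2, §12.5 (Prop. 12.5.1), §3 (Thms. 1, 2, 5). [Aretakis2012]
-/

noncomputable section

open Real Set Filter MeasureTheory intervalIntegral
open scoped Topology ContDiff Manifold

namespace Literature.Barriers.FinalStateConjecture.Kerr

open Literature.Geometry.Lorentzian Literature.Geometry.Lorentzian.Kerr.StarCoord

/-- **A smooth non-negative plateau cut-off**: `χ ∈ C^∞(ℝ)`, `χ = 1` on `(−∞, A']`, `χ = 0` on
`[B', ∞)` (`A' < B'`), `χ ≥ 0`. [folklore] -/
theorem exists_smooth_plateau_nonneg {A' B' : ℝ} (h : A' < B') :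
    ∃ χ : ℝ → ℝ, ContDiff ℝ ∞ χ ∧ (∀ r, r ≤ A' → χ r = 1) ∧ (∀ r, B' ≤ r → χ r = 0) ∧
      ∀ r, 0 ≤ χ r := by
  refine ⟨fun r ↦ Real.smoothTransition ((B' - r) / (B' - A')), ?_, ?_, ?_,
    fun r ↦ Real.smoothTransition.nonneg _⟩
  · exact Real.smoothTransition.contDiff.comp (by fun_prop)
  · intro r hr
    refine Real.smoothTransition.one_of_one_le ?_
    rw [le_div_iff₀ (by linarith)]
    linarith
  · intro r hr
    refine Real.smoothTransition.zero_of_nonpos ?_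
    exact div_nonpos_of_nonpos_of_nonneg (by linarith) (by linarith)

section Collar

variable [Kerr.Facts] [Kerr.SliceFacts] {M r₀ : ℝ} {U₀ : Set (Kerr.region M r₀)} {Φ : E4 → ℝ}

/-- **Aretakis 2012, §13.1 for the class with a three-term integrated decay hypothesis (no
angular derivative).** Let `Φ` be a globally smooth, everywhere axisymmetric member of Aretakis's
class (`□_{g_{M,M}}Φ = 0` on an open `U₀ ⊇ {r ≥ M, t* ≥ 0}`, data vanishing on
`{t* = 0, ‖x⃗‖ > ρ}`), `M < A < B`, `A ≤ 23M/21`, and suppose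
`∫₀^τ ∫₀^{2π}∫₀^π∫_A^B sin θ (Φ² + (TΦ)² + (∂_ρΦ)²)(p(t, r, θ, φ)) dt ≤ I` for all `τ ≥ 0`
(`TΦ = dΦ(p)∂_{t*}`, `∂_ρΦ = dΦ(p)(0, n̂)`). Then there is `C` with
`∫₀^{2π}∫₀^π∫_M^A sin θ (∂_ρΦ)²(p(τ, r, θ, φ)) ≤ C` for all `τ ≥ 0`. Same proof as
`collar_rhoDeriv_sq_le_of_transitionILED` (energy identity `Kerr.mult_identity_of_class` for the
cut-off `N`-current on `[0, τ] × [M, r₂]`; horizon flux `≥ 0`; bulk `≤ 0` on the collar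
(Prop. 7.2.1), `= 0` beyond `B`; density coercive on the collar up to `70M sin θ Φ²`, bounded in the
shell, `= −e_T ≤ 0` beyond `B`; zeroth-order and degenerate terms by the first Hardy inequality and
the boundedness of the `T`-flux; Fubini in `φ₀`), except that the Lagrangian profile is
`w = −χ/2 + ½χ'N^Y`, for which the coefficient `½f' − w = −χ/2` of `(∂_θG)²` in the bulk is `≤ 0`,
so that in the transition shell the bulk is bounded above by `K sin θ ((∂_{t*}G)² + (∂_rG)² + G²)`
(`exists_bound_multBulk_le`) and no angular derivative enters the hypothesis.
[cite: Aretakis2012, §13.1 (proof of Thm. 2) and §7.2] -/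
theorem collar_rhoDeriv_sq_le_of_transitionILED₃ (hM : 0 < M) (hr₀ : r₀ ∈ Set.Ioo 0 M)
    (hU₀ : IsOpen U₀)
    (hKU : {x : Kerr.region M r₀ | Kerr.rPlus M M ≤ Kerr.radius M (x : E4) ∧ 0 ≤ (x : E4) 0} ⊆ U₀)
    (hΦ : ContDiff ℝ ∞ Φ)
    (haxi : ∀ (β : ℝ) (z : E4), Φ (E4.axialRotation β z) = Φ z)
    (hsol : ∀ x ∈ U₀, (Kerr.smoothMetric M M r₀).toPseudoRiemannianMetric.dalembertian
      (fun y : Kerr.region M r₀ ↦ Φ y) x = 0)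
    {ρ : ℝ} (hloc : ∀ x ∈ U₀, (x : E4) 0 = 0 → ρ < E4.spatialNorm (x : E4) →
      Φ x = 0 ∧ fderiv ℝ Φ x = 0)
    {A B I : ℝ} (hMA : M < A) (hAB : A < B) (hA23 : A ≤ 23 / 21 * M)
    (hI : ∀ τ : ℝ, 0 ≤ τ → (∫ t in (0 : ℝ)..τ, shellIntegral A B (fun r θ φ ↦ sin θ *
        (Φ (shellPoint M t r θ φ) ^ 2 +
          (fderiv ℝ Φ (shellPoint M t r θ φ) (E4.basisVector 0)) ^ 2 +
          (fderiv ℝ Φ (shellPoint M t r θ φ) (E4.spaceEmbed (sphRadial θ φ))) ^ 2))) ≤ I) :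
    ∃ C : ℝ, ∀ τ : ℝ, 0 ≤ τ →
      shellIntegral M A (fun r θ φ ↦ sin θ *
        (fderiv ℝ Φ (shellPoint M τ r θ φ) (E4.spaceEmbed (sphRadial θ φ))) ^ 2) ≤ C := by
  obtain ⟨hr₀pos, hr₀M⟩ := hr₀
  have hπ := pi_pos
  have hΦ' : ∀ x ∈ U₀, ContDiffAt ℝ ∞ Φ x := fun x _ ↦ hΦ.contDiffAt
  have haxi' : ∀ (β : ℝ) (z : E4), 0 < Kerr.radius M z → Φ (E4.axialRotation β z) = Φ z :=
    fun β z _ ↦ haxi β z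
  have hdiff : Differentiable ℝ Φ := hΦ.differentiable (by simp)
  have hMA' : M ≤ A := hMA.le
  have hMB : M ≤ B := hMA'.trans hAB.le
  /- ## the pull-back `G = Φ ∘ κ` and the dictionary at box points -/
  have hGs : ContDiff ℝ ∞ (Kerr.starPull M Φ) := hΦ.comp (Kerr.contDiff_starChart M)
  have dict0 : ∀ t r θ φ, Kerr.starPull M Φ (boxPoint φ t r θ) = Φ (shellPoint M t r θ φ) := by
    intro t r θ φ; rw [Kerr.starPull_apply, starChart_boxPoint]
  have dictT : ∀ t r θ φ, pd 0 (Kerr.starPull M Φ) (boxPoint φ t r θ) =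
      fderiv ℝ Φ (shellPoint M t r θ φ) (E4.basisVector 0) := by
    intro t r θ φ; rw [pd_starPull_boxPoint (hdiff _) 0, Kerr.starFrame_zero]
  have dictR : ∀ t r θ φ, pd 1 (Kerr.starPull M Φ) (boxPoint φ t r θ) =
      fderiv ℝ Φ (shellPoint M t r θ φ) (E4.spaceEmbed (sphRadial θ φ)) := by
    intro t r θ φ; rw [pd_starPull_boxPoint (hdiff _) 1, Kerr.starFrame_one]; rfl
  /- ## the cut-off and the profiles -/
  obtain ⟨χ, hχ, hχ1, hχ0, hχnn⟩ := exists_smooth_plateau_nonneg (A' := A + (B - A) / 3)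
    (B' := B - (B - A) / 3) (by linarith)
  have hχ' : ContDiff ℝ ∞ (deriv χ) := (contDiff_infty_iff_deriv.mp hχ).2
  obtain ⟨f, hfdef⟩ : ∃ f : ℝ → ℝ, f = fun r ↦ χ r * nProfileR M r := ⟨_, rfl⟩
  obtain ⟨h, hhdef⟩ : ∃ h : ℝ → ℝ, h = fun r ↦ χ r * nProfileT M r + (1 - χ r) := ⟨_, rfl⟩
  obtain ⟨w, hwdef⟩ : ∃ w : ℝ → ℝ, w = fun r ↦ χ r * nProfileW r +
      1 / 2 * deriv χ r * nProfileR M r := ⟨_, rfl⟩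
  have hf : ContDiff ℝ ∞ f := by rw [hfdef]; exact hχ.mul (contDiff_nProfileR M)
  have hh : ContDiff ℝ ∞ h := by
    rw [hhdef]; exact (hχ.mul (contDiff_nProfileT M)).add (contDiff_const.sub hχ)
  have hw : ContDiff ℝ ∞ w := by
    rw [hwdef]
    exact (hχ.mul contDiff_nProfileW).add ((contDiff_const.mul hχ').mul (contDiff_nProfileR M))
  -- the derivative of the cut-off vanishes near the collar and near the tail
  have hχd1 : ∀ r, r ≤ A → deriv χ =ᶠ[𝓝 r] fun _ ↦ 0 := fun r hr ↦ by
    have h1 : χ =ᶠ[𝓝 r] fun _ ↦ (1 : ℝ) := by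
      filter_upwards [Iio_mem_nhds (show r < A + (B - A) / 3 by linarith)] with s hs
      exact hχ1 s (le_of_lt hs)
    filter_upwards [h1.deriv] with s hs
    rw [hs, deriv_const]
  have hχd0 : ∀ r, B ≤ r → deriv χ =ᶠ[𝓝 r] fun _ ↦ 0 := fun r hr ↦ by
    have h0 : χ =ᶠ[𝓝 r] fun _ ↦ (0 : ℝ) := by
      filter_upwards [Ioi_mem_nhds (show B - (B - A) / 3 < r by linarith)] with s hs
      exact hχ0 s (le_of_lt hs)
    filter_upwards [h0.deriv] with s hs
    rw [hs, deriv_const]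
  -- the sign of the angular coefficient `½f' − w = −χ/2 ≤ 0`
  have hsign : ∀ r, 1 / 2 * deriv f r - w r ≤ 0 := by
    intro r
    have hχdiff : DifferentiableAt ℝ χ r := (hχ.differentiable (by simp)).differentiableAt
    have hnR : DifferentiableAt ℝ (nProfileR M) r :=
      ((contDiff_nProfileR M).differentiable (by simp)).differentiableAt
    have hdf : deriv f r = deriv χ r * nProfileR M r + χ r * deriv (nProfileR M) r := by
      rw [hfdef]; exact deriv_mul hχdiff hnR
    rw [hdf, deriv_nProfileR, hwdef]
    simp only [nProfileW]
    linarith [hχnn r]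
  have hχ1ev : ∀ r, r ≤ A → ∀ᶠ s in 𝓝 r, χ s = 1 := fun r hr ↦ by
    filter_upwards [Iio_mem_nhds (show r < A + (B - A) / 3 by linarith)] with s hs
    exact hχ1 s (le_of_lt hs)
  have hχ0ev : ∀ r, B ≤ r → ∀ᶠ s in 𝓝 r, χ s = 0 := fun r hr ↦ by
    filter_upwards [Ioi_mem_nhds (show B - (B - A) / 3 < r by linarith)] with s hs
    exact hχ0 s (le_of_lt hs)
  have hfN : ∀ r, r ≤ A → f =ᶠ[𝓝 r] nProfileR M := fun r hr ↦ by
    filter_upwards [hχ1ev r hr] with s hs; rw [hfdef]; simp [hs]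
  have hhN : ∀ r, r ≤ A → h =ᶠ[𝓝 r] nProfileT M := fun r hr ↦ by
    filter_upwards [hχ1ev r hr] with s hs; rw [hhdef]; simp [hs]
  have hwN : ∀ r, r ≤ A → w =ᶠ[𝓝 r] nProfileW := fun r hr ↦ by
    filter_upwards [hχ1ev r hr, hχd1 r hr] with s hs hs'; rw [hwdef]; simp [hs, hs']
  have hfT : ∀ r, B ≤ r → f =ᶠ[𝓝 r] fun _ ↦ 0 := fun r hr ↦ by
    filter_upwards [hχ0ev r hr] with s hs; rw [hfdef]; simp [hs]
  have hhT : ∀ r, B ≤ r → h =ᶠ[𝓝 r] fun _ ↦ 1 := fun r hr ↦ by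
    filter_upwards [hχ0ev r hr] with s hs; rw [hhdef]; simp [hs]
  have hwT : ∀ r, B ≤ r → w =ᶠ[𝓝 r] fun _ ↦ 0 := fun r hr ↦ by
    filter_upwards [hχ0ev r hr, hχd0 r hr] with s hs hs'; rw [hwdef]; simp [hs, hs']
  /- ## continuity of the densities of the cut-off current along the boxes -/
  obtain ⟨hEs, -, -, hBc⟩ := contDiffOn_mult (M := M) (a := M) isOpen_univ hGs.contDiffOn hf hh hw
  have cE : Continuous (multDensity M M f h w (Kerr.starPull M Φ)) :=
    (contDiffOn_univ.mp hEs).continuous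
  have cB : Continuous (multBulk M M f h w (Kerr.starPull M Φ)) := continuousOn_univ.mp hBc
  have cE4 : Continuous fun q : ℝ × ℝ × ℝ × ℝ ↦
      multDensity M M f h w (Kerr.starPull M Φ) (boxPoint q.2.2.2 q.1 q.2.1 q.2.2.1) := by
    have hc := cE.comp continuous_boxPoint₄; rw [Function.comp_def] at hc; exact hc
  have cE3 : ∀ φ₀, Continuous fun p : ℝ × ℝ × ℝ ↦
      multDensity M M f h w (Kerr.starPull M Φ) (boxPoint φ₀ p.1 p.2.1 p.2.2) := fun φ₀ ↦ by
    have hc := cE.comp (continuous_boxPoint φ₀); rw [Function.comp_def] at hc; exact hc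
  have cB3 : ∀ φ₀, Continuous fun p : ℝ × ℝ × ℝ ↦
      multBulk M M f h w (Kerr.starPull M Φ) (boxPoint φ₀ p.1 p.2.1 p.2.2) := fun φ₀ ↦ by
    have hc := cB.comp (continuous_boxPoint φ₀); rw [Function.comp_def] at hc; exact hc
  -- the energy-type density `J = sin θ ((∂_{t*}G)² + (∂_rG)² + (∂_θG)² + G²)` and its pieces
  have cpd : ∀ i, Continuous fun q : ℝ × ℝ × ℝ × ℝ ↦
      pd i (Kerr.starPull M Φ) (boxPoint q.2.2.2 q.1 q.2.1 q.2.2.1) := fun i ↦ by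
    have hc := ((hGs.continuous_fderiv (by simp)).clm_apply continuous_const :
      Continuous fun q : E4 ↦ fderiv ℝ (Kerr.starPull M Φ) q (E4.basisVector i)).comp
      continuous_boxPoint₄
    rw [Function.comp_def] at hc; exact hc
  have cG4 : Continuous fun q : ℝ × ℝ × ℝ × ℝ ↦
      Kerr.starPull M Φ (boxPoint q.2.2.2 q.1 q.2.1 q.2.2.1) := by
    have hc := hGs.continuous.comp continuous_boxPoint₄; rw [Function.comp_def] at hc; exact hc
  have csin4 : Continuous fun q : ℝ × ℝ × ℝ × ℝ ↦ sin q.2.2.1 := by fun_prop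
  obtain ⟨J, hJ⟩ : ∃ J : ℝ → ℝ → ℝ → ℝ → ℝ, J = fun t r θ φ ↦ sin θ *
      (pd 0 (Kerr.starPull M Φ) (boxPoint φ t r θ) ^ 2 + pd 1 (Kerr.starPull M Φ) (boxPoint φ t r θ) ^ 2 +
        pd 2 (Kerr.starPull M Φ) (boxPoint φ t r θ) ^ 2 + Kerr.starPull M Φ (boxPoint φ t r θ) ^ 2) :=
    ⟨_, rfl⟩
  have cJ4 : Continuous fun q : ℝ × ℝ × ℝ × ℝ ↦ J q.1 q.2.1 q.2.2.1 q.2.2.2 := by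
    rw [hJ]
    exact csin4.mul (((((cpd 0).pow 2).add ((cpd 1).pow 2)).add ((cpd 2).pow 2)).add (cG4.pow 2))
  -- the same without the angular derivative (for the bulk in the transition shell)
  obtain ⟨J₃, hJ₃⟩ : ∃ J₃ : ℝ → ℝ → ℝ → ℝ → ℝ, J₃ = fun t r θ φ ↦ sin θ *
      (pd 0 (Kerr.starPull M Φ) (boxPoint φ t r θ) ^ 2 + pd 1 (Kerr.starPull M Φ) (boxPoint φ t r θ) ^ 2 +
        Kerr.starPull M Φ (boxPoint φ t r θ) ^ 2) := ⟨_, rfl⟩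
  have cJ₃4 : Continuous fun q : ℝ × ℝ × ℝ × ℝ ↦ J₃ q.1 q.2.1 q.2.2.1 q.2.2.2 := by
    rw [hJ₃]
    exact csin4.mul ((((cpd 0).pow 2).add ((cpd 1).pow 2)).add (cG4.pow 2))
  -- the transversal and zeroth-order densities on the collar
  obtain ⟨P₁, hP₁⟩ : ∃ P₁ : ℝ → ℝ → ℝ → ℝ → ℝ, P₁ = fun t r θ φ ↦ sin θ *
      pd 1 (Kerr.starPull M Φ) (boxPoint φ t r θ) ^ 2 := ⟨_, rfl⟩
  have cP₁ : Continuous fun q : ℝ × ℝ × ℝ × ℝ ↦ P₁ q.1 q.2.1 q.2.2.1 q.2.2.2 := by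
    rw [hP₁]; exact csin4.mul ((cpd 1).pow 2)
  obtain ⟨Z₁, hZ₁⟩ : ∃ Z₁ : ℝ → ℝ → ℝ → ℝ → ℝ, Z₁ = fun t r θ φ ↦ sin θ *
      Kerr.starPull M Φ (boxPoint φ t r θ) ^ 2 := ⟨_, rfl⟩
  have cZ₁ : Continuous fun q : ℝ × ℝ × ℝ × ℝ ↦ Z₁ q.1 q.2.1 q.2.2.1 q.2.2.2 := by
    rw [hZ₁]; exact csin4.mul (cG4.pow 2)
  /- ## the constants -/
  obtain ⟨Kb, hKb0, hKb⟩ := exists_bound_multBulk_le M M A B hf hh hw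
  obtain ⟨Ke, hKe0, hKe⟩ := exists_bound_multDensity M M A B hf hh hw
  obtain ⟨E₀, hE₀⟩ : ∃ E₀ : ℝ, E₀ = shellIntegral M (max ρ (2 * M) + 2)
      (fun r θ φ ↦ degTEnergyDensity M Φ 0 r θ φ) := ⟨_, rfl⟩
  have hE₀0 : 0 ≤ E₀ := hE₀ ▸ initialDegTEnergyShell_nonneg hM hΦ ρ
  obtain ⟨m₀, hm₀⟩ : ∃ m₀ : ℝ, m₀ = min (min ((A - M) ^ 2) (A ^ 2)) 1 := ⟨_, rfl⟩
  have hm₀pos : 0 < m₀ := by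
    rw [hm₀]; exact lt_min (lt_min (by nlinarith) (by nlinarith)) zero_lt_one
  -- the initial `N`-energy per unit `φ*` and its integral
  obtain ⟨Einit, hEinit⟩ : ∃ Einit : ℝ → ℝ, Einit = fun φ₀ ↦ ∫ θ in (0 : ℝ)..π,
      ∫ r in M..(max ρ (2 * M) + 2), multDensity M M f h w (Kerr.starPull M Φ) (boxPoint φ₀ 0 r θ) :=
    ⟨_, rfl⟩
  have cEinit : Continuous Einit := by
    rw [hEinit]
    have hc := continuous_boxIntegral_param₂
      (J := fun t r θ φ ↦ multDensity M M f h w (Kerr.starPull M Φ) (boxPoint φ t r θ)) cE4 M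
      (max ρ (2 * M) + 2)
    have hc2 : Continuous fun φ₀ : ℝ ↦ ((0, φ₀) : ℝ × ℝ) := by fun_prop
    have hc3 := hc.comp hc2
    rw [Function.comp_def] at hc3
    exact hc3
  obtain ⟨Cinit, hCinit⟩ : ∃ Cinit : ℝ, Cinit = ∫ φ₀ in (0 : ℝ)..2 * π, Einit φ₀ := ⟨_, rfl⟩
  -- the final constant
  refine ⟨16 / M ^ 3 * (|Cinit| + Kb * |I| + 70 * M * (8 * E₀) + Ke * (2 / m₀ * E₀ + 8 * E₀)),
    fun τ hτ ↦ ?_⟩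
  /- ## the outer radius, beyond the support of the wave on `[0, τ]` -/
  obtain ⟨r₂, hr₂⟩ : ∃ r₂ : ℝ, r₂ = max B (max ρ (2 * M) + τ + 2) := ⟨_, rfl⟩
  have hBr₂ : B ≤ r₂ := hr₂ ▸ le_max_left _ _
  have hr₂' : max ρ (2 * M) + τ + 2 ≤ r₂ := hr₂ ▸ le_max_right _ _
  have hfar₂ : max ρ (2 * M) + 1 + τ < r₂ := by linarith
  have hR₀r₂ : max ρ (2 * M) + 2 ≤ r₂ := by linarith
  have hMr₂ : M ≤ r₂ := hMB.trans hBr₂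
  have hMR₀ : M ≤ max ρ (2 * M) + 2 := by have := le_max_right ρ (2 * M); linarith
  /- ## the per-`φ₀` estimate -/
  have key : ∀ φ₀ : ℝ,
      M ^ 3 / 16 * (∫ θ in (0 : ℝ)..π, ∫ r in M..A, P₁ τ r θ φ₀) ≤
        -Einit φ₀ + Kb * (∫ t in (0 : ℝ)..τ, ∫ θ in (0 : ℝ)..π, ∫ r in A..B, J₃ t r θ φ₀) +
          70 * M * (∫ θ in (0 : ℝ)..π, ∫ r in M..A, Z₁ τ r θ φ₀) +
          Ke * (∫ θ in (0 : ℝ)..π, ∫ r in A..B, J τ r θ φ₀) := by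
    intro φ₀
    -- (I) the energy identity and the sign of the horizon flux
    have hid := mult_identity_of_class hM ⟨hr₀pos, hr₀M⟩ hU₀ hKU hΦ' haxi' hsol hloc hf hh hw
      (t₁ := 0) (t₂ := τ) (T := τ) (r₂ := r₂) (φ₀ := φ₀) le_rfl hτ le_rfl hfar₂
    have hF : 0 ≤ ∫ t in (0 : ℝ)..τ, ∫ θ in (0 : ℝ)..π,
        multFluxR M M f h w (Kerr.starPull M Φ) (boxPoint φ₀ t M θ) := by
      refine intervalIntegral.integral_nonneg hτ fun t _ ↦
        intervalIntegral.integral_nonneg hπ.le fun θ hθ ↦ ?_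
      rw [multFluxR_congr_nhds (f₂ := nProfileR M) (h₂ := nProfileT M) (w₂ := nProfileW)
        (by rw [boxPoint_apply_one]; exact (hfN M hMA').eq_of_nhds)
        (by rw [boxPoint_apply_one]; exact (hhN M hMA').eq_of_nhds)
        (by rw [boxPoint_apply_one]; exact hwN M hMA')]
      exact multFluxR_nCurrent_horizon_nonneg hM.le _ (boxPoint_apply_one _ _ _ _)
        (by rw [boxPoint_apply_two]; exact hθ)
    -- (II) the bulk: sign on the collar, zero beyond `B`, bounded in the shell
    have hIb : ∀ t ∈ Icc 0 τ, (∫ θ in (0 : ℝ)..π, ∫ r in M..r₂,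
        multBulk M M f h w (Kerr.starPull M Φ) (boxPoint φ₀ t r θ)) ≤
        Kb * ∫ θ in (0 : ℝ)..π, ∫ r in A..B, J₃ t r θ φ₀ := by
      intro t _
      have hc := continuous_uncurry_of_param
        (g := fun t r θ ↦ multBulk M M f h w (Kerr.starPull M Φ) (boxPoint φ₀ t r θ)) (cB3 φ₀) t
      rw [boxIntegral_split (b := A) hc, boxIntegral_split (a := A) (b := B) (c := r₂) hc]
      have h1 : (∫ θ in (0 : ℝ)..π, ∫ r in M..A,
          multBulk M M f h w (Kerr.starPull M Φ) (boxPoint φ₀ t r θ)) ≤ 0 := by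
        refine boxIntegral_nonpos hMA' hc fun r hr θ hθ ↦ ?_
        rw [multBulk_congr_nhds (f₂ := nProfileR M) (h₂ := nProfileT M) (w₂ := nProfileW)
          (by rw [boxPoint_apply_one]; exact hfN r hr.2)
          (by rw [boxPoint_apply_one]; exact hhN r hr.2)
          (by rw [boxPoint_apply_one]; exact hwN r hr.2)]
        exact multBulk_nCurrent_nonpos hM _ (by rw [boxPoint_apply_one]; exact hr.1)
          (by rw [boxPoint_apply_one]; exact hr.2.trans hA23) (by rw [boxPoint_apply_two]; exact hθ)
      have h2 : (∫ θ in (0 : ℝ)..π, ∫ r in A..B,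
          multBulk M M f h w (Kerr.starPull M Φ) (boxPoint φ₀ t r θ)) ≤
          ∫ θ in (0 : ℝ)..π, ∫ r in A..B, Kb * J₃ t r θ φ₀ := by
        have hcJ : Continuous (Function.uncurry fun r θ ↦ Kb * J₃ t r θ φ₀) := by
          have hc1 : Continuous fun x : ℝ × ℝ ↦ ((t, x.1, x.2, φ₀) : ℝ × ℝ × ℝ × ℝ) := by fun_prop
          have hc2 := cJ₃4.comp hc1
          rw [Function.comp_def] at hc2
          exact continuous_const.mul hc2
        refine boxIntegral_mono_on hAB.le hc hcJ fun r hr θ hθ ↦ ?_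
        have hb := hKb (Kerr.starPull M Φ) (boxPoint φ₀ t r θ) (by rw [boxPoint_apply_one]; exact hr)
          (by rw [boxPoint_apply_two]; exact hθ) (by rw [boxPoint_apply_one]; exact hsign r)
        rw [hJ₃]; simpa only [boxPoint_apply_two] using hb
      have h3 : (∫ θ in (0 : ℝ)..π, ∫ r in B..r₂,
          multBulk M M f h w (Kerr.starPull M Φ) (boxPoint φ₀ t r θ)) = 0 := by
        refine boxIntegral_eq_zero_of fun r hr θ _ ↦ ?_
        rw [uIcc_of_le hBr₂] at hr
        rw [multBulk_congr_nhds (f₂ := fun _ ↦ 0) (h₂ := fun _ ↦ 1) (w₂ := fun _ ↦ 0)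
          (by rw [boxPoint_apply_one]; exact hfT r hr.1)
          (by rw [boxPoint_apply_one]; exact hhT r hr.1)
          (by rw [boxPoint_apply_one]; exact hwT r hr.1)]
        exact multBulk_T M M _ _
      rw [boxIntegral_const_mul] at h2
      linarith
    -- (III) integrate the bulk bound in time
    have hIbt : (∫ t in (0 : ℝ)..τ, ∫ θ in (0 : ℝ)..π, ∫ r in M..r₂,
        multBulk M M f h w (Kerr.starPull M Φ) (boxPoint φ₀ t r θ)) ≤
        Kb * ∫ t in (0 : ℝ)..τ, ∫ θ in (0 : ℝ)..π, ∫ r in A..B, J₃ t r θ φ₀ := by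
      rw [← intervalIntegral.integral_const_mul]
      have hcJt : Continuous fun t ↦ ∫ θ in (0 : ℝ)..π, ∫ r in A..B, J₃ t r θ φ₀ := by
        have hc1 : Continuous fun p : ℝ × ℝ × ℝ ↦ ((p.1, p.2.1, p.2.2, φ₀) : ℝ × ℝ × ℝ × ℝ) := by
          fun_prop
        have hc2 := cJ₃4.comp hc1
        rw [Function.comp_def] at hc2
        exact continuous_boxIntegral_param (g := fun t r θ ↦ J₃ t r θ φ₀) hc2 A B
      exact intervalIntegral.integral_mono_on hτ
        ((continuous_boxIntegral_param
          (g := fun t r θ ↦ multBulk M M f h w (Kerr.starPull M Φ) (boxPoint φ₀ t r θ)) (cB3 φ₀) M r₂).intervalIntegrable _ _)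
        ((continuous_const.mul hcJt).intervalIntegrable _ _) fun t ht ↦ by
          simpa only using (hIb t ht)
    -- (IV) the initial energy: the density vanishes beyond `R₀` at `t* = 0`
    have hI0 : (∫ θ in (0 : ℝ)..π, ∫ r in M..r₂,
        multDensity M M f h w (Kerr.starPull M Φ) (boxPoint φ₀ 0 r θ)) = Einit φ₀ := by
      rw [hEinit]
      have hc := continuous_uncurry_of_param
        (g := fun t r θ ↦ multDensity M M f h w (Kerr.starPull M Φ) (boxPoint φ₀ t r θ)) (cE3 φ₀) 0
      rw [boxIntegral_split (b := max ρ (2 * M) + 2) hc,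
        boxIntegral_eq_zero_of (a := max ρ (2 * M) + 2) (b := r₂), add_zero]
      intro r hr θ _
      rw [uIcc_of_le hR₀r₂] at hr
      have hfar₀ : max ρ (2 * M) + 1 + 0 < r := by linarith [hr.1]
      obtain ⟨hΦ0, hdΦ0⟩ := fderiv_shellPoint_eq_zero_of_far hM ⟨hr₀pos, hr₀M⟩ hU₀ hKU hΦ' hsol
        hloc hfar₀ le_rfl le_rfl θ φ₀
      have hG0 : Kerr.starPull M Φ (boxPoint φ₀ 0 r θ) = 0 := by rw [dict0]; exact hΦ0
      have hpd : ∀ i, pd i (Kerr.starPull M Φ) (boxPoint φ₀ 0 r θ) = 0 := fun i ↦ by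
        rw [pd_starPull_boxPoint (hdiff _) i, hdΦ0]; rfl
      rw [multDensity_eq_quadratic]
      simp only [hG0, hpd, mul_zero, add_zero, zero_pow two_ne_zero]
    -- (V) the energy at time `τ`: collar, shell, tail
    have hcEτ := continuous_uncurry_of_param
      (g := fun t r θ ↦ multDensity M M f h w (Kerr.starPull M Φ) (boxPoint φ₀ t r θ)) (cE3 φ₀) τ
    have hV1 : (∫ θ in (0 : ℝ)..π, ∫ r in M..A,
        multDensity M M f h w (Kerr.starPull M Φ) (boxPoint φ₀ τ r θ)) ≤
        -(M ^ 3 / 16) * (∫ θ in (0 : ℝ)..π, ∫ r in M..A, P₁ τ r θ φ₀) +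
          70 * M * (∫ θ in (0 : ℝ)..π, ∫ r in M..A, Z₁ τ r θ φ₀) := by
      have hcP : Continuous (Function.uncurry fun r θ ↦ P₁ τ r θ φ₀) := by
        have hc1 : Continuous fun x : ℝ × ℝ ↦ ((τ, x.1, x.2, φ₀) : ℝ × ℝ × ℝ × ℝ) := by fun_prop
        have hc2 := cP₁.comp hc1; rw [Function.comp_def] at hc2; exact hc2
      have hcZ : Continuous (Function.uncurry fun r θ ↦ Z₁ τ r θ φ₀) := by
        have hc1 : Continuous fun x : ℝ × ℝ ↦ ((τ, x.1, x.2, φ₀) : ℝ × ℝ × ℝ × ℝ) := by fun_prop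
        have hc2 := cZ₁.comp hc1; rw [Function.comp_def] at hc2; exact hc2
      have hcP' : Continuous (Function.uncurry fun r θ ↦ -(M ^ 3 / 16) * P₁ τ r θ φ₀) :=
        continuous_const.mul hcP
      have hcZ' : Continuous (Function.uncurry fun r θ ↦ 70 * M * Z₁ τ r θ φ₀) :=
        continuous_const.mul hcZ
      have hcomb : Continuous (Function.uncurry fun r θ ↦
          -(M ^ 3 / 16) * P₁ τ r θ φ₀ + 70 * M * Z₁ τ r θ φ₀) := hcP'.add hcZ'
      have hle := boxIntegral_mono_on hMA' hcEτ hcomb fun r hr θ hθ ↦ by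
        have hq := nEnergy_collar_ge hM (Kerr.starPull M Φ) (q := boxPoint φ₀ τ r θ)
          (by rw [boxPoint_apply_one]; exact hr.1) (by rw [boxPoint_apply_one]; exact hr.2.trans hA23)
          (by rw [boxPoint_apply_two]; exact hθ)
        rw [multDensity_congr (f₂ := nProfileR M) (h₂ := nProfileT M) (w₂ := nProfileW)
          (by rw [boxPoint_apply_one]; exact (hfN r hr.2).eq_of_nhds)
          (by rw [boxPoint_apply_one]; exact (hhN r hr.2).eq_of_nhds)
          (by rw [boxPoint_apply_one]; exact (hwN r hr.2).eq_of_nhds)]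
        rw [hP₁, hZ₁]
        simp only [boxPoint_apply_two] at hq
        linarith
      rw [boxIntegral_add hcP' hcZ', boxIntegral_const_mul, boxIntegral_const_mul] at hle
      exact hle
    have hV2 : (∫ θ in (0 : ℝ)..π, ∫ r in A..B,
        multDensity M M f h w (Kerr.starPull M Φ) (boxPoint φ₀ τ r θ)) ≤
        Ke * ∫ θ in (0 : ℝ)..π, ∫ r in A..B, J τ r θ φ₀ := by
      have hcJ : Continuous (Function.uncurry fun r θ ↦ Ke * J τ r θ φ₀) := by
        have hc1 : Continuous fun x : ℝ × ℝ ↦ ((τ, x.1, x.2, φ₀) : ℝ × ℝ × ℝ × ℝ) := by fun_prop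
        have hc2 := cJ4.comp hc1
        rw [Function.comp_def] at hc2
        exact continuous_const.mul hc2
      rw [← boxIntegral_const_mul]
      refine boxIntegral_mono_on hAB.le hcEτ hcJ fun r hr θ hθ ↦ (le_abs_self _).trans ?_
      have hb := hKe (Kerr.starPull M Φ) (boxPoint φ₀ τ r θ) (by rw [boxPoint_apply_one]; exact hr)
        (by rw [boxPoint_apply_two]; exact hθ)
      rw [hJ]; simpa only [boxPoint_apply_two] using hb
    have hV3 : (∫ θ in (0 : ℝ)..π, ∫ r in B..r₂,
        multDensity M M f h w (Kerr.starPull M Φ) (boxPoint φ₀ τ r θ)) ≤ 0 := by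
      refine boxIntegral_nonpos hBr₂ hcEτ fun r hr θ hθ ↦ ?_
      rw [multDensity_congr (f₂ := fun _ ↦ 0) (h₂ := fun _ ↦ 1) (w₂ := fun _ ↦ 0)
        (by rw [boxPoint_apply_one]; exact (hfT r hr.1).eq_of_nhds)
        (by rw [boxPoint_apply_one]; exact (hhT r hr.1).eq_of_nhds)
        (by rw [boxPoint_apply_one]; exact (hwT r hr.1).eq_of_nhds), multDensity_T]
      have h0 := tEnergy_extremal_nonneg hM.le (Kerr.starPull M Φ) (q := boxPoint φ₀ τ r θ)
        (by rw [boxPoint_apply_one]; linarith [hr.1]) (by rw [boxPoint_apply_two]; exact hθ)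
      linarith
    have hV : (∫ θ in (0 : ℝ)..π, ∫ r in M..r₂,
        multDensity M M f h w (Kerr.starPull M Φ) (boxPoint φ₀ τ r θ)) ≤
        -(M ^ 3 / 16) * (∫ θ in (0 : ℝ)..π, ∫ r in M..A, P₁ τ r θ φ₀) +
          70 * M * (∫ θ in (0 : ℝ)..π, ∫ r in M..A, Z₁ τ r θ φ₀) +
          Ke * ∫ θ in (0 : ℝ)..π, ∫ r in A..B, J τ r θ φ₀ := by
      rw [boxIntegral_split (b := A) hcEτ, boxIntegral_split (a := A) (b := B) (c := r₂) hcEτ]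
      linarith
    -- (VI) combine
    rw [hI0] at hid
    linarith
  /- ## integrate over `φ₀ ∈ [0, 2π]` -/
  have h2π : (0 : ℝ) ≤ 2 * π := by positivity
  -- continuity in `φ₀` of the five terms
  have cPφ : Continuous fun φ₀ ↦ ∫ θ in (0 : ℝ)..π, ∫ r in M..A, P₁ τ r θ φ₀ := by
    have hc := continuous_boxIntegral_param₂ (J := P₁) cP₁ M A
    have hc2 : Continuous fun φ₀ : ℝ ↦ ((τ, φ₀) : ℝ × ℝ) := by fun_prop
    have hc3 := hc.comp hc2; rw [Function.comp_def] at hc3; exact hc3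
  have cZφ : Continuous fun φ₀ ↦ ∫ θ in (0 : ℝ)..π, ∫ r in M..A, Z₁ τ r θ φ₀ := by
    have hc := continuous_boxIntegral_param₂ (J := Z₁) cZ₁ M A
    have hc2 : Continuous fun φ₀ : ℝ ↦ ((τ, φ₀) : ℝ × ℝ) := by fun_prop
    have hc3 := hc.comp hc2; rw [Function.comp_def] at hc3; exact hc3
  have cJ2 : Continuous fun p : ℝ × ℝ ↦ ∫ θ in (0 : ℝ)..π, ∫ r in A..B, J p.1 r θ p.2 :=
    continuous_boxIntegral_param₂ (J := J) cJ4 A B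
  have cJφ : Continuous fun φ₀ ↦ ∫ θ in (0 : ℝ)..π, ∫ r in A..B, J τ r θ φ₀ := by
    have hc2 : Continuous fun φ₀ : ℝ ↦ ((τ, φ₀) : ℝ × ℝ) := by fun_prop
    have hc3 := cJ2.comp hc2; rw [Function.comp_def] at hc3; exact hc3
  have cJ2₃ : Continuous fun p : ℝ × ℝ ↦ ∫ θ in (0 : ℝ)..π, ∫ r in A..B, J₃ p.1 r θ p.2 :=
    continuous_boxIntegral_param₂ (J := J₃) cJ₃4 A B
  have cJswap : Continuous (Function.uncurry fun φ₀ t ↦ ∫ θ in (0 : ℝ)..π, ∫ r in A..B, J₃ t r θ φ₀) := by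
    have hc := cJ2₃.comp continuous_swap; rw [Function.comp_def] at hc; exact hc
  have cJtφ : Continuous fun φ₀ ↦ ∫ t in (0 : ℝ)..τ, ∫ θ in (0 : ℝ)..π, ∫ r in A..B, J₃ t r θ φ₀ :=
    intervalIntegral.continuous_parametric_intervalIntegral_of_continuous' cJswap 0 τ
  -- integrate the per-`φ₀` estimate
  have c1 : Continuous fun φ₀ ↦ -Einit φ₀ := cEinit.neg
  have cX : Continuous fun φ₀ ↦ Kb * ∫ t in (0 : ℝ)..τ, ∫ θ in (0 : ℝ)..π, ∫ r in A..B, J₃ t r θ φ₀ :=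
    continuous_const.mul cJtφ
  have c3 : Continuous fun φ₀ ↦ 70 * M * ∫ θ in (0 : ℝ)..π, ∫ r in M..A, Z₁ τ r θ φ₀ :=
    continuous_const.mul cZφ
  have c4 : Continuous fun φ₀ ↦ Ke * ∫ θ in (0 : ℝ)..π, ∫ r in A..B, J τ r θ φ₀ :=
    continuous_const.mul cJφ
  have c12 : Continuous fun φ₀ ↦ -Einit φ₀ +
      Kb * ∫ t in (0 : ℝ)..τ, ∫ θ in (0 : ℝ)..π, ∫ r in A..B, J₃ t r θ φ₀ := c1.add cX
  have c123 : Continuous fun φ₀ ↦ -Einit φ₀ +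
      Kb * (∫ t in (0 : ℝ)..τ, ∫ θ in (0 : ℝ)..π, ∫ r in A..B, J₃ t r θ φ₀) +
      70 * M * ∫ θ in (0 : ℝ)..π, ∫ r in M..A, Z₁ τ r θ φ₀ := c12.add c3
  have c1234 : Continuous fun φ₀ ↦ -Einit φ₀ +
      Kb * (∫ t in (0 : ℝ)..τ, ∫ θ in (0 : ℝ)..π, ∫ r in A..B, J₃ t r θ φ₀) +
      70 * M * (∫ θ in (0 : ℝ)..π, ∫ r in M..A, Z₁ τ r θ φ₀) +
      Ke * ∫ θ in (0 : ℝ)..π, ∫ r in A..B, J τ r θ φ₀ := c123.add c4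
  have cL : Continuous fun φ₀ ↦ M ^ 3 / 16 * ∫ θ in (0 : ℝ)..π, ∫ r in M..A, P₁ τ r θ φ₀ :=
    continuous_const.mul cPφ
  have hint := intervalIntegral.integral_mono_on (μ := volume) h2π (cL.intervalIntegrable _ _)
    (c1234.intervalIntegrable _ _) fun φ₀ _ ↦ key φ₀
  rw [intervalIntegral.integral_const_mul,
    intervalIntegral.integral_add (c123.intervalIntegrable _ _) (c4.intervalIntegrable _ _),
    intervalIntegral.integral_add (c12.intervalIntegrable _ _) (c3.intervalIntegrable _ _),
    intervalIntegral.integral_add (c1.intervalIntegrable _ _) (cX.intervalIntegrable _ _),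
    intervalIntegral.integral_neg, intervalIntegral.integral_const_mul,
    intervalIntegral.integral_const_mul, intervalIntegral.integral_const_mul, ← hCinit] at hint
  -- Fubini for the time integral and the hypothesis
  have hswap : (∫ φ₀ in (0 : ℝ)..2 * π, ∫ t in (0 : ℝ)..τ, ∫ θ in (0 : ℝ)..π, ∫ r in A..B, J₃ t r θ φ₀) =
      ∫ t in (0 : ℝ)..τ, shellIntegral A B (fun r θ φ ↦ J₃ t r θ φ) := by
    rw [intervalIntegral_swap_of_continuous cJswap h2π hτ]
    rfl
  have hJΦ : (fun t ↦ shellIntegral A B (fun r θ φ ↦ J₃ t r θ φ)) = fun t ↦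
      shellIntegral A B (fun r θ φ ↦ sin θ *
        (Φ (shellPoint M t r θ φ) ^ 2 +
          (fderiv ℝ Φ (shellPoint M t r θ φ) (E4.basisVector 0)) ^ 2 +
          (fderiv ℝ Φ (shellPoint M t r θ φ) (E4.spaceEmbed (sphRadial θ φ))) ^ 2)) := by
    funext t
    congr 1
    funext r θ φ
    rw [hJ₃]
    simp only [dict0, dictT, dictR]
    ring
  have hIτ : (∫ t in (0 : ℝ)..τ, shellIntegral A B (fun r θ φ ↦ J₃ t r θ φ)) ≤ |I| := by
    rw [hJΦ]; exact (hI τ hτ).trans (le_abs_self I)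
  -- the zeroth-order term on the collar: Hardy
  have hZ : (∫ φ₀ in (0 : ℝ)..2 * π, ∫ θ in (0 : ℝ)..π, ∫ r in M..A, Z₁ τ r θ φ₀) ≤ 8 * E₀ := by
    have h8 := shellIntegral_sq_le_initialEnergy hM ⟨hr₀pos, hr₀M⟩ hU₀ hKU hΦ haxi hsol hloc hτ hMA'
    rw [← hE₀] at h8
    have heq : (∫ φ₀ in (0 : ℝ)..2 * π, ∫ θ in (0 : ℝ)..π, ∫ r in M..A, Z₁ τ r θ φ₀) =
        shellIntegral M A (fun r θ φ ↦ sin θ * Φ (shellPoint M τ r θ φ) ^ 2) := by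
      rw [hZ₁]; simp only [dict0]; rfl
    rw [heq]; exact h8
  -- the transition shell at time `τ`: degenerate energy and Hardy
  have hJτ : (∫ φ₀ in (0 : ℝ)..2 * π, ∫ θ in (0 : ℝ)..π, ∫ r in A..B, J τ r θ φ₀) ≤
      2 / m₀ * E₀ + 8 * E₀ := by
    have hΦ1 : ContDiff ℝ 1 Φ := hΦ.of_le (by exact_mod_cast le_top)
    -- pointwise: `J ≤ (2/m₀) e_T + sin θ Φ²`
    have hcJ3 : Continuous fun q : ℝ × ℝ × ℝ ↦ J τ q.1 q.2.1 q.2.2 := by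
      have hc1 : Continuous fun x : ℝ × ℝ × ℝ ↦ ((τ, x.1, x.2.1, x.2.2) : ℝ × ℝ × ℝ × ℝ) := by fun_prop
      have hc2 := cJ4.comp hc1; rw [Function.comp_def] at hc2; exact hc2
    have hsq : Continuous fun q : ℝ × ℝ × ℝ ↦ sin q.2.1 * Φ (shellPoint M τ q.1 q.2.1 q.2.2) ^ 2 :=
      (continuous_sin.comp (continuous_fst.comp continuous_snd)).mul
        ((hΦ.continuous.comp (continuous_shellPoint M τ)).pow 2)
    have hcomb : Continuous fun q : ℝ × ℝ × ℝ ↦ 2 / m₀ * degTEnergyDensity M Φ τ q.1 q.2.1 q.2.2 +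
        sin q.2.1 * Φ (shellPoint M τ q.1 q.2.1 q.2.2) ^ 2 :=
      (continuous_const.mul (continuous_degTEnergyDensity₃ hΦ1 M τ)).add hsq
    have hle : shellIntegral A B (fun r θ φ ↦ J τ r θ φ) ≤
        shellIntegral A B (fun r θ φ ↦ 2 / m₀ * degTEnergyDensity M Φ τ r θ φ +
          sin θ * Φ (shellPoint M τ r θ φ) ^ 2) := by
      refine shellIntegral_mono_on hAB.le hcJ3 hcomb fun r hr θ hθ φ _ ↦ ?_
      have hq := sin_mul_sq_le_tEnergy hM hMA (Kerr.starPull M Φ) (q := boxPoint φ τ r θ)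
        (by rw [boxPoint_apply_one]; exact hr.1) (by rw [boxPoint_apply_two]; exact hθ)
      rw [← hm₀, boxPoint_apply_two, tEnergy_starPull_boxPoint (hdiff _)] at hq
      have hdiv : sin θ * (pd 0 (Kerr.starPull M Φ) (boxPoint φ τ r θ) ^ 2 +
          pd 1 (Kerr.starPull M Φ) (boxPoint φ τ r θ) ^ 2 + pd 2 (Kerr.starPull M Φ) (boxPoint φ τ r θ) ^ 2) ≤
          2 / m₀ * degTEnergyDensity M Φ τ r θ φ := by
        rw [div_mul_eq_mul_div, le_div_iff₀ hm₀pos]; linarith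
      rw [hJ]
      simp only [dict0]
      linarith
    rw [shellIntegral_add (continuous_const.mul (continuous_degTEnergyDensity₃ hΦ1 M τ)) hsq,
      shellIntegral_const_mul] at hle
    have h1 : shellIntegral A B (fun r θ φ ↦ degTEnergyDensity M Φ τ r θ φ) ≤ E₀ := by
      have hmono := shellIntegral_mono_interval (g := fun r θ φ ↦ degTEnergyDensity M Φ τ r θ φ)
        hMA' hAB.le le_rfl (continuous_degTEnergyDensity₃ hΦ1 M τ)
        fun r hr θ hθ φ _ ↦ degTEnergyDensity_nonneg hM.le Φ τ (hM.le.trans hr.1) hθ φ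
      have hb := degTEnergyShell_le_initial hM ⟨hr₀pos, hr₀M⟩ hU₀ hKU hΦ haxi hsol hloc hτ hMB
      rw [← hE₀] at hb
      exact hmono.trans hb
    have h2 : shellIntegral A B (fun r θ φ ↦ sin θ * Φ (shellPoint M τ r θ φ) ^ 2) ≤ 8 * E₀ := by
      have hmono := shellIntegral_mono_interval (g := fun r θ φ ↦ sin θ * Φ (shellPoint M τ r θ φ) ^ 2)
        hMA' hAB.le le_rfl hsq
        fun r _ θ hθ φ _ ↦ mul_nonneg (sin_nonneg_of_nonneg_of_le_pi hθ.1 hθ.2) (sq_nonneg _)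
      have hb := shellIntegral_sq_le_initialEnergy hM ⟨hr₀pos, hr₀M⟩ hU₀ hKU hΦ haxi hsol hloc hτ hMB
      rw [← hE₀] at hb
      exact hmono.trans hb
    have heq : (∫ φ₀ in (0 : ℝ)..2 * π, ∫ θ in (0 : ℝ)..π, ∫ r in A..B, J τ r θ φ₀) =
        shellIntegral A B (fun r θ φ ↦ J τ r θ φ) := rfl
    rw [heq]
    have hm2 : 0 ≤ 2 / m₀ := by positivity
    nlinarith [mul_le_mul_of_nonneg_left h1 hm2]
  -- the left-hand side is the collar integral
  have hlhs : (∫ φ₀ in (0 : ℝ)..2 * π, ∫ θ in (0 : ℝ)..π, ∫ r in M..A, P₁ τ r θ φ₀) =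
      shellIntegral M A (fun r θ φ ↦ sin θ *
        (fderiv ℝ Φ (shellPoint M τ r θ φ) (E4.spaceEmbed (sphRadial θ φ))) ^ 2) := by
    rw [hP₁]; simp only [dictR]; rfl
  rw [hlhs, hswap] at hint
  -- assemble
  have hM3 : 0 < M ^ 3 := pow_pos hM 3
  have hKbI : Kb * (∫ t in (0 : ℝ)..τ, shellIntegral A B (fun r θ φ ↦ J₃ t r θ φ)) ≤ Kb * |I| :=
    mul_le_mul_of_nonneg_left hIτ hKb0
  have hKeJ := mul_le_mul_of_nonneg_left hJτ hKe0
  have h70 : 70 * M * (∫ φ₀ in (0 : ℝ)..2 * π, ∫ θ in (0 : ℝ)..π, ∫ r in M..A, Z₁ τ r θ φ₀) ≤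
      70 * M * (8 * E₀) := mul_le_mul_of_nonneg_left hZ (by positivity)
  rw [div_mul_eq_mul_div, le_div_iff₀ hM3]
  have hC := neg_le_abs Cinit
  nlinarith

end Collar

/-! ### The time integrals over the transition shell from `Aretakis2012_integratedDecay` -/

/-- A continuous non-negative function whose tail is integrable has uniformly bounded integrals
`∫₀^τ`, `τ ≥ 0`. [folklore] -/
theorem intervalIntegral_le_of_integrableOn_Ioi {G : ℝ → ℝ} (hG : Continuous G) (hG0 : ∀ t, 0 ≤ G t)
    {T₀ : ℝ} (hint : IntegrableOn G (Ioi T₀)) {τ : ℝ} (hτ : 0 ≤ τ) :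
    (∫ t in (0 : ℝ)..τ, G t) ≤ (∫ t in (0 : ℝ)..T₀, G t) + ∫ t in Ioi T₀, G t := by
  have htail : 0 ≤ ∫ t in Ioi T₀, G t := setIntegral_nonneg measurableSet_Ioi fun t _ ↦ hG0 t
  rcases le_or_gt τ T₀ with hle | hlt
  · have h1 : (∫ t in (0 : ℝ)..τ, G t) ≤ ∫ t in (0 : ℝ)..T₀, G t :=
      intervalIntegral.integral_mono_interval le_rfl hτ hle
        (Eventually.of_forall fun t ↦ hG0 t) (hG.intervalIntegrable _ _)
    linarith
  · rw [← intervalIntegral.integral_add_adjacent_intervals (hG.intervalIntegrable 0 T₀)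
      (hG.intervalIntegrable T₀ τ), intervalIntegral.integral_of_le hlt.le]
    have h2 : (∫ t in Ioc T₀ τ, G t) ≤ ∫ t in Ioi T₀, G t :=
      setIntegral_mono_set hint (Eventually.of_forall fun t ↦ hG0 t) Ioc_subset_Ioi_self.eventuallyLE
    linarith

end Literature.Barriers.FinalStateConjecture.Kerr

namespace Literature.Barriers.FinalStateConjecture

open Literature.Geometry.Lorentzian Kerr

/-- **`Aretakis2012_uniformBoundedness` from the three-term integrated decay in a transition shell**
(as `Aretakis2012_uniformBoundedness_of_transitionILED`, without the angular derivative).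
[cite: Aretakis2012, §13.1, §12.5 (Prop. 12.5.1), §3 (Thm. 2)] -/
theorem Aretakis2012_uniformBoundedness_of_transitionILED₃
    (Hiled : ∀ [Kerr.Facts] [Kerr.SliceFacts] (M : ℝ), 0 < M → ∀ r₀ ∈ Set.Ioo 0 M,
      ∀ (U₀ : Set (Kerr.region M r₀)) (Φ : E4 → ℝ), IsOpen U₀ →
        {x : Kerr.region M r₀ | Kerr.rPlus M M ≤ Kerr.radius M (x : E4) ∧ 0 ≤ (x : E4) 0} ⊆ U₀ →
        ContDiff ℝ ∞ Φ →
        (∀ x ∈ U₀, (Kerr.smoothMetric M M r₀).toPseudoRiemannianMetric.dalembertian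
          (fun y : Kerr.region M r₀ ↦ Φ y) x = 0) →
        (∃ ρ : ℝ, ∀ x ∈ U₀, (x : E4) 0 = 0 → ρ < E4.spatialNorm (x : E4) →
          Φ x = 0 ∧ fderiv ℝ Φ x = 0) →
        (∀ (β : ℝ) (z : E4), Φ (E4.axialRotation β z) = Φ z) →
        ∃ A B I : ℝ, M < A ∧ A < B ∧ A ≤ 23 / 21 * M ∧ ∀ τ : ℝ, 0 ≤ τ →
          (∫ t in (0 : ℝ)..τ, Kerr.shellIntegral A B (fun r θ φ ↦ Real.sin θ *
            (Φ (Kerr.shellPoint M t r θ φ) ^ 2 +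
              (fderiv ℝ Φ (Kerr.shellPoint M t r θ φ) (E4.basisVector 0)) ^ 2 +
              (fderiv ℝ Φ (Kerr.shellPoint M t r θ φ) (E4.spaceEmbed (sphRadial θ φ))) ^ 2))) ≤ I) :
    Aretakis2012_uniformBoundedness := by
  refine Aretakis2012_uniformBoundedness_of_nearHorizonBound ?_
  intro _ _ M hM r₀ hr₀ U₀ Φ hU₀ hKU hΦ hsol hloc haxi
  obtain ⟨A, B, I, hMA, hAB, hA23, hI⟩ := Hiled M hM r₀ hr₀ U₀ Φ hU₀ hKU hΦ hsol hloc haxi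
  obtain ⟨ρ, hρ⟩ := hloc
  obtain ⟨C, hC⟩ := collar_rhoDeriv_sq_le_of_transitionILED₃ hM hr₀ hU₀ hKU hΦ haxi hsol hρ hMA
    hAB hA23 hI
  refine ⟨A - M, 0, C, by linarith, fun τ hτ ↦ ?_⟩
  rw [show M + (A - M) = A by ring]
  exact hC τ hτ

/-- **Child 1 from child 2: `Aretakis2012_integratedDecay → Aretakis2012_uniformBoundedness`.**
For a member `Φ` of the class apply `Aretakis2012_integratedDecay` to `Φ` and to `TΦ` (the class
is closed under `T`, `Kerr.timeDeriv_in_class`), obtaining radii `R₂, R₂' > M` and thresholds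
`τ₀, τ₀'`; on the shell `[A, B]`, `A = (2M + R)/3`, `B = (M + 2R)/3`, `R = min(R₂, R₂', 23M/21)`,
`sin θ (Φ² + (TΦ)² + (∂_ρΦ)²) ≤ max(1, (A − M)⁻²) sin θ (Φ² + (r − M)²(∂_ρΦ)²) + sin θ ((TΦ)² + (r − M)²(∂_ρTΦ)²)`,
so the time integrals `∫₀^τ` of the three-term shell integral are bounded by
`∫₀^{T₀} + ∫_{(T₀,∞)}` of the dominating integrable function (`T₀ = max(τ₀, τ₀', 0)`), and
`Aretakis2012_uniformBoundedness_of_transitionILED₃` applies. [cite: Aretakis2012, §13.1 and §3 (Thms. 1, 2)] -/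
theorem Aretakis2012_uniformBoundedness_of_integratedDecay (hdec : Aretakis2012_integratedDecay) :
    Aretakis2012_uniformBoundedness := by
  refine Aretakis2012_uniformBoundedness_of_transitionILED₃ ?_
  intro _ _ M hM r₀ hr₀ U₀ Φ hU₀ hKU hΦ hsol hloc haxi
  obtain ⟨ρ, hρ⟩ := hloc
  have hΦ1 : ContDiff ℝ 1 Φ := hΦ.of_le (by exact_mod_cast le_top)
  -- the fact for `Φ` and for `TΦ`
  obtain ⟨hT, hsolT, hlocT, haxiT⟩ := Kerr.timeDeriv_in_class hM.le hΦ hU₀ hsol hρ haxi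
  have hT1 : ContDiff ℝ 1 (fun y ↦ fderiv ℝ Φ y (E4.basisVector 0)) := hT.of_le (by exact_mod_cast le_top)
  obtain ⟨R₂, τ₀, hR₂, hint⟩ := hdec M hM r₀ hr₀ U₀ Φ hU₀ hKU hΦ hsol ⟨ρ, hρ⟩ haxi
  obtain ⟨R₂', τ₀', hR₂', hint'⟩ := hdec M hM r₀ hr₀ U₀ (fun y ↦ fderiv ℝ Φ y (E4.basisVector 0))
    hU₀ hKU hT hsolT ⟨ρ, hlocT⟩ haxiT
  -- radii
  obtain ⟨R, hR⟩ : ∃ R : ℝ, R = min (min R₂ R₂') (23 / 21 * M) := ⟨_, rfl⟩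
  have hMR : M < R := by rw [hR]; exact lt_min (lt_min hR₂ hR₂') (by linarith)
  have hRR₂ : R ≤ R₂ := hR ▸ (min_le_left _ _).trans (min_le_left _ _)
  have hRR₂' : R ≤ R₂' := hR ▸ (min_le_left _ _).trans (min_le_right _ _)
  have hR23 : R ≤ 23 / 21 * M := hR ▸ min_le_right _ _
  obtain ⟨A, hA⟩ : ∃ A : ℝ, A = (2 * M + R) / 3 := ⟨_, rfl⟩
  obtain ⟨B, hB⟩ : ∃ B : ℝ, B = (M + 2 * R) / 3 := ⟨_, rfl⟩
  have hMA : M < A := by rw [hA]; linarith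
  have hAB : A < B := by rw [hA, hB]; linarith
  have hBR : B < R := by rw [hB]; linarith
  have hA23 : A ≤ 23 / 21 * M := by rw [hA]; linarith
  -- the dominating function and its constant
  obtain ⟨c, hc⟩ : ∃ c : ℝ, c = max 1 (1 / (A - M) ^ 2) := ⟨_, rfl⟩
  have hc1 : 1 ≤ c := hc ▸ le_max_left _ _
  have hc2 : 1 / (A - M) ^ 2 ≤ c := hc ▸ le_max_right _ _
  have hc0 : 0 ≤ c := zero_le_one.trans hc1
  obtain ⟨T₀, hT₀⟩ : ∃ T₀ : ℝ, T₀ = max (max τ₀ τ₀') 0 := ⟨_, rfl⟩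
  have hT₀τ₀ : τ₀ ≤ T₀ := hT₀ ▸ (le_max_left _ _).trans (le_max_left _ _)
  have hT₀τ₀' : τ₀' ≤ T₀ := hT₀ ▸ (le_max_right _ _).trans (le_max_left _ _)
  -- names for the three time-dependent shell integrals
  obtain ⟨g₁, hg₁⟩ : ∃ g₁ : ℝ → ℝ, g₁ = fun t ↦ shellIntegral M R₂ (fun r θ φ ↦ Real.sin θ *
      (Φ (shellPoint M t r θ φ) ^ 2 + (r - M) ^ 2 *
        (fderiv ℝ Φ (shellPoint M t r θ φ) (E4.spaceEmbed (sphRadial θ φ))) ^ 2)) := ⟨_, rfl⟩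
  obtain ⟨g₂, hg₂⟩ : ∃ g₂ : ℝ → ℝ, g₂ = fun t ↦ shellIntegral M R₂' (fun r θ φ ↦ Real.sin θ *
      ((fun y ↦ fderiv ℝ Φ y (E4.basisVector 0)) (shellPoint M t r θ φ) ^ 2 + (r - M) ^ 2 *
        (fderiv ℝ (fun y ↦ fderiv ℝ Φ y (E4.basisVector 0)) (shellPoint M t r θ φ)
          (E4.spaceEmbed (sphRadial θ φ))) ^ 2)) := ⟨_, rfl⟩
  obtain ⟨F, hF⟩ : ∃ F : ℝ → ℝ, F = fun t ↦ shellIntegral A B (fun r θ φ ↦ Real.sin θ *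
      (Φ (shellPoint M t r θ φ) ^ 2 +
        (fderiv ℝ Φ (shellPoint M t r θ φ) (E4.basisVector 0)) ^ 2 +
        (fderiv ℝ Φ (shellPoint M t r θ φ) (E4.spaceEmbed (sphRadial θ φ))) ^ 2)) := ⟨_, rfl⟩
  have hint₁ : IntegrableOn g₁ (Ioi τ₀) := by rw [hg₁]; exact hint
  have hint₂ : IntegrableOn g₂ (Ioi τ₀') := by rw [hg₂]; exact hint'
  -- continuity in all four variables of the integrands
  have cΦ4 : Continuous fun q : ℝ × ℝ × ℝ × ℝ ↦ Φ (shellPoint M q.1 q.2.1 q.2.2.1 q.2.2.2) :=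
    hΦ.continuous.comp (continuous_shellPoint₄ M)
  have cD4 := continuous_rhoDeriv_shellPoint₄ hΦ1 M
  have cT4 : Continuous fun q : ℝ × ℝ × ℝ × ℝ ↦
      fderiv ℝ Φ (shellPoint M q.1 q.2.1 q.2.2.1 q.2.2.2) (E4.basisVector 0) :=
    ((hΦ1.continuous_fderiv one_ne_zero).comp (continuous_shellPoint₄ M)).clm_apply continuous_const
  have cTD4 := continuous_rhoDeriv_shellPoint₄ hT1 M
  have csin : Continuous fun q : ℝ × ℝ × ℝ × ℝ ↦ Real.sin q.2.2.1 := by fun_prop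
  have crM : Continuous fun q : ℝ × ℝ × ℝ × ℝ ↦ (q.2.1 - M) ^ 2 := by fun_prop
  have cg₁ : Continuous g₁ := by
    rw [hg₁]; exact continuous_shellIntegral (csin.mul ((cΦ4.pow 2).add (crM.mul (cD4.pow 2))))
  have cg₂ : Continuous g₂ := by
    rw [hg₂]; exact continuous_shellIntegral (csin.mul ((cT4.pow 2).add (crM.mul (cTD4.pow 2))))
  have cF : Continuous F := by
    rw [hF]; exact continuous_shellIntegral (csin.mul (((cΦ4.pow 2).add (cT4.pow 2)).add (cD4.pow 2)))
  -- pointwise domination `F ≤ c g₁ + g₂` and signs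
  have hdom : ∀ t, F t ≤ c * g₁ t + g₂ t := by
    intro t
    have c3 : ∀ {H : ℝ → ℝ → ℝ → ℝ → ℝ}, (Continuous fun q : ℝ × ℝ × ℝ × ℝ ↦ H q.1 q.2.1 q.2.2.1 q.2.2.2) →
        Continuous fun q : ℝ × ℝ × ℝ ↦ H t q.1 q.2.1 q.2.2 := by
      intro H hH
      have hc1 : Continuous fun x : ℝ × ℝ × ℝ ↦ ((t, x.1, x.2.1, x.2.2) : ℝ × ℝ × ℝ × ℝ) := by fun_prop
      have hc2 := hH.comp hc1; rw [Function.comp_def] at hc2; exact hc2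
    have cΦ3 := c3 (H := fun t r θ φ ↦ Φ (shellPoint M t r θ φ)) cΦ4
    have cD3 := c3 (H := fun t r θ φ ↦
      fderiv ℝ Φ (shellPoint M t r θ φ) (E4.spaceEmbed (sphRadial θ φ))) cD4
    have cT3 := c3 (H := fun t r θ φ ↦ fderiv ℝ Φ (shellPoint M t r θ φ) (E4.basisVector 0)) cT4
    have cTD3 := c3 (H := fun t r θ φ ↦ fderiv ℝ (fun y ↦ fderiv ℝ Φ y (E4.basisVector 0))
      (shellPoint M t r θ φ) (E4.spaceEmbed (sphRadial θ φ))) cTD4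
    have csin3 : Continuous fun q : ℝ × ℝ × ℝ ↦ Real.sin q.2.1 := by fun_prop
    have crM3 : Continuous fun q : ℝ × ℝ × ℝ ↦ (q.1 - M) ^ 2 := by fun_prop
    have hF3 : Continuous fun q : ℝ × ℝ × ℝ ↦ Real.sin q.2.1 *
        (Φ (shellPoint M t q.1 q.2.1 q.2.2) ^ 2 +
          (fderiv ℝ Φ (shellPoint M t q.1 q.2.1 q.2.2) (E4.basisVector 0)) ^ 2 +
          (fderiv ℝ Φ (shellPoint M t q.1 q.2.1 q.2.2) (E4.spaceEmbed (sphRadial q.2.1 q.2.2))) ^ 2) :=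
      csin3.mul (((cΦ3.pow 2).add (cT3.pow 2)).add (cD3.pow 2))
    have hG₁3 : Continuous fun q : ℝ × ℝ × ℝ ↦ Real.sin q.2.1 *
        (Φ (shellPoint M t q.1 q.2.1 q.2.2) ^ 2 + (q.1 - M) ^ 2 *
          (fderiv ℝ Φ (shellPoint M t q.1 q.2.1 q.2.2) (E4.spaceEmbed (sphRadial q.2.1 q.2.2))) ^ 2) :=
      csin3.mul ((cΦ3.pow 2).add (crM3.mul (cD3.pow 2)))
    have hG₂3 : Continuous fun q : ℝ × ℝ × ℝ ↦ Real.sin q.2.1 *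
        ((fun y ↦ fderiv ℝ Φ y (E4.basisVector 0)) (shellPoint M t q.1 q.2.1 q.2.2) ^ 2 + (q.1 - M) ^ 2 *
          (fderiv ℝ (fun y ↦ fderiv ℝ Φ y (E4.basisVector 0)) (shellPoint M t q.1 q.2.1 q.2.2)
            (E4.spaceEmbed (sphRadial q.2.1 q.2.2))) ^ 2) :=
      csin3.mul ((cT3.pow 2).add (crM3.mul (cTD3.pow 2)))
    have hcomb : Continuous fun q : ℝ × ℝ × ℝ ↦ c * (Real.sin q.2.1 *
        (Φ (shellPoint M t q.1 q.2.1 q.2.2) ^ 2 + (q.1 - M) ^ 2 *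
          (fderiv ℝ Φ (shellPoint M t q.1 q.2.1 q.2.2) (E4.spaceEmbed (sphRadial q.2.1 q.2.2))) ^ 2)) +
        Real.sin q.2.1 *
        ((fun y ↦ fderiv ℝ Φ y (E4.basisVector 0)) (shellPoint M t q.1 q.2.1 q.2.2) ^ 2 + (q.1 - M) ^ 2 *
          (fderiv ℝ (fun y ↦ fderiv ℝ Φ y (E4.basisVector 0)) (shellPoint M t q.1 q.2.1 q.2.2)
            (E4.spaceEmbed (sphRadial q.2.1 q.2.2))) ^ 2) := (continuous_const.mul hG₁3).add hG₂3
    -- (i) pointwise on the shell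
    have h1 : F t ≤ shellIntegral A B (fun r θ φ ↦ c * (Real.sin θ *
        (Φ (shellPoint M t r θ φ) ^ 2 + (r - M) ^ 2 *
          (fderiv ℝ Φ (shellPoint M t r θ φ) (E4.spaceEmbed (sphRadial θ φ))) ^ 2)) +
        Real.sin θ *
        ((fun y ↦ fderiv ℝ Φ y (E4.basisVector 0)) (shellPoint M t r θ φ) ^ 2 + (r - M) ^ 2 *
          (fderiv ℝ (fun y ↦ fderiv ℝ Φ y (E4.basisVector 0)) (shellPoint M t r θ φ)
            (E4.spaceEmbed (sphRadial θ φ))) ^ 2)) := by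
      rw [hF]
      refine shellIntegral_mono_on hAB.le hF3 hcomb fun r hr θ hθ φ _ ↦ ?_
      have hs : 0 ≤ Real.sin θ := Real.sin_nonneg_of_nonneg_of_le_pi hθ.1 hθ.2
      have hrM : (A - M) ^ 2 ≤ (r - M) ^ 2 := pow_le_pow_left₀ (by linarith) (by linarith [hr.1]) 2
      have hAM : 0 < (A - M) ^ 2 := pow_pos (by linarith) 2
      have hcw : 1 ≤ c * (r - M) ^ 2 := by
        have h := mul_le_mul hc2 hrM hAM.le hc0
        rwa [one_div, inv_mul_cancel₀ hAM.ne'] at h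
      set X := Φ (shellPoint M t r θ φ) ^ 2
      set Y := (fderiv ℝ Φ (shellPoint M t r θ φ) (E4.basisVector 0)) ^ 2
      set Z := (fderiv ℝ Φ (shellPoint M t r θ φ) (E4.spaceEmbed (sphRadial θ φ))) ^ 2
      set W := (fderiv ℝ (fun y ↦ fderiv ℝ Φ y (E4.basisVector 0)) (shellPoint M t r θ φ)
            (E4.spaceEmbed (sphRadial θ φ))) ^ 2
      have hX : 0 ≤ X := sq_nonneg _
      have hZ : 0 ≤ Z := sq_nonneg _
      have hW : 0 ≤ W := sq_nonneg _
      show Real.sin θ * (X + Y + Z) ≤ c * (Real.sin θ * (X + (r - M) ^ 2 * Z)) + Real.sin θ * (Y + (r - M) ^ 2 * W)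
      nlinarith [mul_nonneg hs (mul_nonneg (sub_nonneg.mpr hc1) hX),
        mul_nonneg hs (mul_nonneg (sub_nonneg.mpr hcw) hZ),
        mul_nonneg hs (mul_nonneg (sq_nonneg (r - M)) hW)]
    -- (ii) linearity and enlarging the shells
    rw [shellIntegral_add (continuous_const.mul hG₁3) hG₂3, shellIntegral_const_mul] at h1
    have h2 : shellIntegral A B (fun r θ φ ↦ Real.sin θ *
        (Φ (shellPoint M t r θ φ) ^ 2 + (r - M) ^ 2 *
          (fderiv ℝ Φ (shellPoint M t r θ φ) (E4.spaceEmbed (sphRadial θ φ))) ^ 2)) ≤ g₁ t := by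
      rw [hg₁]
      exact shellIntegral_mono_interval hMA.le hAB.le (hBR.le.trans hRR₂) hG₁3
        fun r _ θ hθ φ _ ↦ mul_nonneg (Real.sin_nonneg_of_nonneg_of_le_pi hθ.1 hθ.2)
          (add_nonneg (sq_nonneg _) (mul_nonneg (sq_nonneg _) (sq_nonneg _)))
    have h3 : shellIntegral A B (fun r θ φ ↦ Real.sin θ *
        ((fun y ↦ fderiv ℝ Φ y (E4.basisVector 0)) (shellPoint M t r θ φ) ^ 2 + (r - M) ^ 2 *
          (fderiv ℝ (fun y ↦ fderiv ℝ Φ y (E4.basisVector 0)) (shellPoint M t r θ φ)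
            (E4.spaceEmbed (sphRadial θ φ))) ^ 2)) ≤ g₂ t := by
      rw [hg₂]
      exact shellIntegral_mono_interval hMA.le hAB.le (hBR.le.trans hRR₂') hG₂3
        fun r _ θ hθ φ _ ↦ mul_nonneg (Real.sin_nonneg_of_nonneg_of_le_pi hθ.1 hθ.2)
          (add_nonneg (sq_nonneg _) (mul_nonneg (sq_nonneg _) (sq_nonneg _)))
    nlinarith [mul_le_mul_of_nonneg_left h2 hc0]
  have hF0 : ∀ t, 0 ≤ F t := fun t ↦ by
    rw [hF]
    have c3Φ : Continuous fun q : ℝ × ℝ × ℝ ↦ Φ (shellPoint M t q.1 q.2.1 q.2.2) :=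
      hΦ.continuous.comp (continuous_shellPoint M t)
    have c3T : Continuous fun q : ℝ × ℝ × ℝ ↦ fderiv ℝ Φ (shellPoint M t q.1 q.2.1 q.2.2) (E4.basisVector 0) :=
      ((hΦ1.continuous_fderiv one_ne_zero).comp (continuous_shellPoint M t)).clm_apply continuous_const
    have c3D : Continuous fun q : ℝ × ℝ × ℝ ↦
        fderiv ℝ Φ (shellPoint M t q.1 q.2.1 q.2.2) (E4.spaceEmbed (sphRadial q.2.1 q.2.2)) :=
      ((hΦ1.continuous_fderiv one_ne_zero).comp (continuous_shellPoint M t)).clm_apply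
        (continuous_spaceEmbed_sphRadial.comp continuous_snd)
    refine shellIntegral_nonneg hAB.le ((Real.continuous_sin.comp (continuous_fst.comp continuous_snd)).mul
      (((c3Φ.pow 2).add (c3T.pow 2)).add (c3D.pow 2))) fun r _ θ hθ φ _ ↦ ?_
    exact mul_nonneg (Real.sin_nonneg_of_nonneg_of_le_pi hθ.1 hθ.2) (by positivity)
  have hG0 : ∀ t, 0 ≤ c * g₁ t + g₂ t := fun t ↦ (hF0 t).trans (hdom t)
  have hintG : IntegrableOn (fun t ↦ c * g₁ t + g₂ t) (Ioi T₀) :=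
    ((hint₁.mono_set (Ioi_subset_Ioi hT₀τ₀)).const_mul c).add (hint₂.mono_set (Ioi_subset_Ioi hT₀τ₀'))
  have cG : Continuous fun t ↦ c * g₁ t + g₂ t := (continuous_const.mul cg₁).add cg₂
  -- the bound
  refine ⟨A, B, (∫ t in (0 : ℝ)..T₀, (c * g₁ t + g₂ t)) + ∫ t in Ioi T₀, (c * g₁ t + g₂ t),
    hMA, hAB, hA23, fun τ hτ ↦ ?_⟩
  have hFG : (∫ t in (0 : ℝ)..τ, F t) ≤ ∫ t in (0 : ℝ)..τ, (c * g₁ t + g₂ t) :=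
    intervalIntegral.integral_mono_on hτ (cF.intervalIntegrable _ _) (cG.intervalIntegrable _ _)
      fun t _ ↦ hdom t
  have hGI := intervalIntegral_le_of_integrableOn_Ioi cG hG0 hintG hτ
  have hFτ : (∫ t in (0 : ℝ)..τ, F t) = ∫ t in (0 : ℝ)..τ, shellIntegral A B (fun r θ φ ↦ Real.sin θ *
      (Φ (shellPoint M t r θ φ) ^ 2 +
        (fderiv ℝ Φ (shellPoint M t r θ φ) (E4.basisVector 0)) ^ 2 +
        (fderiv ℝ Φ (shellPoint M t r θ φ) (E4.spaceEmbed (sphRadial θ φ))) ^ 2)) := by rw [hF]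
  rw [← hFτ]
  exact hFG.trans hGI

/-- **The parent from child 2 alone: `Aretakis2012_integratedDecay → Aretakis2012_pointwiseDecay`**
(Aretakis 2012, Thm. 5 from the integrated decay statements, via Thm. 2 for the class proved
here). [cite: Aretakis2012, §3 (Thms. 1, 2, 5), §13.1, §15] -/
theorem Aretakis2012_pointwiseDecay_of_integratedDecay (hdec : Aretakis2012_integratedDecay) :
    Aretakis2012_pointwiseDecay :=
  Aretakis2012_pointwiseDecay_holds_of (Aretakis2012_uniformBoundedness_of_integratedDecay hdec) hdec

end Literature.Barriers.FinalStateConjecture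

end
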